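import Literature.NumberTheory.LFunctions.CertifiedLFunctionTimeAliasingBound
import Literature.NumberTheory.LFunctions.CertifiedDirichletLTuringConvexity
import HarnessLib

/-!
# Booker's time-domain aliasing bound `Σ_{k ≥ 0} F(t ± kB)` for Dirichlet `L`-functions
# (Experiment. Math. 15 (2006), Lemma 5.7, degree one, with Booker's own constants)

Topic `Literature/NumberTheory/LFunctions`; namespace `Literature.NumberTheory.LFunctions`, engine
sub-namespace `TimeAliasingBooker`. Everything in this file is PROVED (no named fact, no new definition).
Typed for the parity-realchar cell (D-0088 (4) literature-typing layer, row «Booker 2006 (Artin, Turing,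
class numbers)» / «Platt 2016»): instrument provenance for Booker's rigorous FFT method for `Λ(s)` (§5),
the source of Platt's Algorithm 2. Companion of `CertifiedLFunctionTimeAliasingBound.lean` (Platt's
Lemma 7.6 = this lemma "with Lemma 7.3 in place of the bound for `L_χ(s)`") and of
`CertifiedDirichletLTuringConvexity.lean` (Booker's Lemma 4.1, which with Lemma 4.5 gives `|F(t)| ≤ E`).

Source: A. R. Booker, *Artin's conjecture, Turing's method, and the Riemann hypothesis*, Experiment.
Math. **15** (2006) 385–407 [Booker2006], §5.3 "Asymptotics", Lemma 5.7 with proof = arXiv:math/0507502v1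
§5.3, last lemma (LaTeX source `turing.tex` ll. 1937–2001, read there). Printed (degree `r`):
"**Lemma 5.7.** Let `t ∈ ℝ` and put `s = ½ + it`,
`E = Z_θ(3/2)^r |γ(s)| e^{(πr/4)ηt} |Q(s) P(s+1)²P(s−2)/(P(s)²P(s−1))|^{1/2}`, and
`β = πr/4 − ½ Σ_{j=1}^r arctan(Re(s+μ_j)/|Im(s+μ_j)|) − (4/π²) Σ_{j=1}^r 1/|Im(s+μ_j)² − Re(s+μ_j)²|`.
(i) If `Im(s+μ_j) > 0` for all `j = 1, …, r` and `β − (πr/4)η > 0` then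
`|Σ_{k=0}^∞ F(t+kB)| ≤ E/(1 − e^{−(β − (πr/4)η)B})`.
(ii) If `Im(s+μ_j) < 0` for all `j = 1, …, r` and `β + (πr/4)η > 0` then
`|Σ_{k=0}^∞ F(t−kB)| ≤ E/(1 − e^{−(β + (πr/4)η)B})`."
Here (§1.3, §5) `γ(s) = ε N^{½(s−½)} Π_j Γ_ℝ(s+μ_j)`, `Γ_ℝ(s) = π^{−s/2}Γ(s/2)`, `Λ = γL`,
`F(t) := Λ(½+it) e^{(πr/4)ηt}` (`η ∈ (−1,1)`), `Q(s) = N Π_j (s+μ_j)/(2π)`, `P` collects the poles of `L`,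
`Z_θ(σ) = (ζ(σ+θ)ζ(σ−θ))^{1/2}` (Lemma 4.5), `B > 0`.

## What is typed (degree one)

For a primitive Dirichlet character `χ` modulo `q > 1`: `r = 1`, `N = q`, `μ₁ = a = charParity χ`, `θ = 0`
(`Z₀(3/2) = ζ(3/2)`, the tree's `Booker2006Turing.bigZ (3/2)`), `P = 1`, `|ε| = 1`; thus
`Im(s+μ₁) = t`, `Re(s+μ₁) = ½ + a`, `Q(s) = q(s+a)/(2π)`. `booker2006_lemma57_i_dirichlet` and
`booker2006_lemma57_ii_dirichlet` are (i) and (ii) verbatim in these terms (`F`, `E`, `β` as functions with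
their defining equations), with absolute convergence of the sums added to the conclusions. `|η| < 1` is
not needed and not assumed. At `|t| = ½ + a`, where the printed `β` has a zero denominator, Lean's
`4/0 = 0` value (`β = π/8`) is covered by the proofs (no definedness hypothesis).

A gap in the printed proof, closed here (as in the companion file): "`≤ −βkB`" uses that
`1/|Im(s*+μ)² − Re(s*+μ)²|` does not increase along the segment from `s` to `s + ikB`, which holds only
when `|Im(s+μ)| > Re(s+μ)`, i.e. `|t| > ½ + a`; the hypotheses allow `0 < |t| < ½ + a` (odd `χ`, e.g.
`t = 0.8`, `η < −0.01`). On that range `β < 0` (even: `4/(π²(¼−t²)) ≥ 16/π²`; odd: seventeen cells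
`[t₁, t₂] ⊂ (0, 3/2)` with `arctan(3/(2t)) = π/2 − arctan(2t/3) ≥ π/2 − (w − w³/3 + w⁵/5)`, `w = 2t₂/3`,
and `π² < 9.8697` — the margin is `0.0067` near `t = 0.81`), while the rate
`½ Im ψ((c+iτ)/2) − τ/(2(c²+τ²)) ≥ τ/(2(c²+τ²)) > 0` by the first term of `Im ψ(w) = Σ_k Im w/|w+k|²`;
so the printed conclusion holds on the whole printed range.

## Method (the printed proof, r = 1)

`|F(u)| ≤ E(u)`: `|L(½+iu, χ)| ≤ ζ(3/2)|Q(½+iu)|^{1/2}` (Lemmas 4.1 + 4.5: the tree's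
`BookerConvexity.norm_LFunction_half_le_bigZ_mul_sqrt`), `|ε| = |q^{iu/2}| = 1`, `|π^{−(c+iu)/2}| = π^{−c/2}`
(`TimeAliasingBooker.norm_F_le`). "By the mean value theorem
`log(|γ(s+ikB)/γ(s)| |Q(s+ikB)/Q(s)|^{1/2}) = −kB Im(γ'/γ + ½Q'/Q)(s*)` … Using (4.3), this is
`≤ −kB(π/4 − ½arctan(Re(s*+μ)/Im(s*+μ)) − (4/π²)/|Im(s*+μ)² − Re(s*+μ)²|) ≤ −βkB`": here
`φ(u) = log‖Γ((c+iu)/2)‖ + ¼log(c²+u²) + βu` is antitone on `[t, ∞)` (`TimeAliasingBooker.decay`),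
since `φ'(u) = −½ Im ψ((c+iu)/2) + u/(2(c²+u²)) + β ≤ 0` (`TimeAliasingBooker.rate`): for `u > c` from
Lehman's (4.3) in the form `Im ψ(x+iy) ≥ π/2 − arctan(x/y) + y/(2(x²+y²)) − 2/(π²(y²−x²))` (the
companion's `TimeAliasing.lehman_le_im_digamma`; the `−1/(2z)` terms of `γ'/γ` and `½Q'/Q` cancel, so
no slack is needed — `TimeAliasingBooker.lehman_route`) and monotonicity (`TimeAliasing.booker_rate_mono`);
for `u ≤ c` as described above; at the junk points `t = c` (`β = π/8`) by four series terms (even) and four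
second-order-Stirling cells (odd, `TimeAliasingBooker.stirling_le_im_digamma` from the tree's
`DigammaLehman.norm_digamma_sub_stirling_two_le`) on `[c, 3]`, Lehman beyond. "Thus
`|F(t+kB)| ≤ E e^{−(β−(π/4)η)kB}`. The conclusion follows" (geometric series; (ii) by `u ↦ −u`, `η ↦ −η`,
`|Γ(z̄)| = |Γ(z)|`): `TimeAliasingBooker.tail_right`, `tail_left`.

`lean search` / tree inventory (2026-08-27): Lemma 5.7 was in the tree only in Platt's form (majorant
`(3/2+|t|)^{5/16}`, Platt's `β`); Booker's `E` and `β` (sharper arctan term for odd `χ`, `|Q(s)|^{1/2}`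
growth) were not. Reused: `TimeAliasing.{sum_le_im_digamma, lehman_le_im_digamma, booker_rate_mono,
hasDerivAt_log_norm_Gamma}`, `BookerConvexity.norm_LFunction_half_le_bigZ_mul_sqrt`,
`DigammaLehman.norm_digamma_sub_stirling_two_le`, Mathlib's `antitoneOn_of_hasDerivWithinAt_nonpos`,
`hasSum_geometric_of_lt_one`. Nothing is restated.

## References

* [Booker2006] A. R. Booker, *Artin's conjecture, Turing's method, and the Riemann hypothesis*,
  Experiment. Math. 15 (2006) 385–407: §5.3 Lemma 5.7 and proof; §4 (4.3), Lemmas 4.1, 4.5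
  (arXiv:math/0507502v1).
* [Lehman1970] R. S. Lehman, *On the distribution of zeros of the Riemann zeta-function*, Proc. LMS (3)
  20 (1970) 303–320, Lemma 8 (Booker's (4.3)).
* [WhittakerWatson1927] E. T. Whittaker, G. N. Watson, *A course of modern analysis*, §12.33 (Stirling's
  series for `ψ`, second order).
-/

noncomputable section

open Complex Filter Topology Set DirichletCharacter
open scoped Real

namespace Literature.NumberTheory.LFunctions

namespace TimeAliasingBooker

open TimeAliasing

/-! ## §1 Elementary helpers -/

/-- `(c + iτ)/2 = c/2 + i(τ/2)` with real casts. [folklore] -/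
private theorem half_arg (c τ : ℝ) :
    ((c : ℂ) + τ * I) / 2 = ((c / 2 : ℝ) : ℂ) + ((τ / 2 : ℝ) : ℂ) * I := by
  push_cast; ring

/-- `arctan v ≤ v` for `v ≥ 0`. [folklore] -/
private theorem arctan_le_self {v : ℝ} (hv : 0 ≤ v) : Real.arctan v ≤ v := by
  rcases hv.eq_or_lt with h | h
  · rw [← h, Real.arctan_zero]
  · have h1 : 0 < Real.arctan v := by
      rw [← Real.arctan_zero]; exact Real.arctan_strictMono h
    have := Real.le_tan h1.le (Real.arctan_lt_pi_div_two v)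
    rwa [Real.tan_arctan] at this

/-- `arctan w ≤ w − w³/3 + w⁵/5` for `w ≥ 0` (the derivative of the difference is
`1 − w² + w⁴ − 1/(1+w²) = w⁶/(1+w²) ≥ 0`). [folklore] -/
private theorem arctan_le_poly5 {w : ℝ} (hw : 0 ≤ w) : Real.arctan w ≤ w - w ^ 3 / 3 + w ^ 5 / 5 := by
  let g : ℝ → ℝ := fun u => u - u ^ 3 / 3 + u ^ 5 / 5 - Real.arctan u
  let g' : ℝ → ℝ := fun u => 1 - (3 : ℕ) * u ^ (3 - 1) / 3 + (5 : ℕ) * u ^ (5 - 1) / 5 - 1 / (1 + u ^ 2)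
  have hg : ∀ x, HasDerivAt g (g' x) x := by
    intro x
    have h1 : HasDerivAt (fun u : ℝ => u - u ^ 3 / 3 + u ^ 5 / 5)
        (1 - (3 : ℕ) * x ^ (3 - 1) / 3 + (5 : ℕ) * x ^ (5 - 1) / 5) x :=
      ((hasDerivAt_id x).sub ((hasDerivAt_pow 3 x).div_const 3)).add ((hasDerivAt_pow 5 x).div_const 5)
    exact h1.sub (Real.hasDerivAt_arctan x)
  have hmono : MonotoneOn g (Ici 0) := by
    refine monotoneOn_of_hasDerivWithinAt_nonneg (convex_Ici 0) (f' := g')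
      (fun x _ => (hg x).continuousAt.continuousWithinAt)
      (fun x _ => (hg x).hasDerivWithinAt) ?_
    intro x _
    show 0 ≤ 1 - (3 : ℕ) * x ^ (3 - 1) / 3 + (5 : ℕ) * x ^ (5 - 1) / 5 - 1 / (1 + x ^ 2)
    have h0 : 0 < 1 + x ^ 2 := by positivity
    rw [show 1 - (3 : ℕ) * x ^ (3 - 1) / 3 + (5 : ℕ) * x ^ (5 - 1) / 5 - 1 / (1 + x ^ 2) =
      x ^ 6 / (1 + x ^ 2) by push_cast; field_simp; ring]
    positivity
  have h := hmono (self_mem_Ici (a := (0 : ℝ))) (show w ∈ Ici (0 : ℝ) from hw) hw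
  simp only [g, Real.arctan_zero] at h
  norm_num at h
  linarith

/-- `‖Γ((c + iu)/2)‖ = ‖Γ((c + i|u|)/2)‖` (`Γ(conj z) = conj Γ(z)`, `c` real). [folklore] -/
private theorem norm_Gamma_abs (c u : ℝ) :
    ‖Complex.Gamma (((c : ℂ) + u * I) / 2)‖ = ‖Complex.Gamma (((c : ℂ) + |u| * I) / 2)‖ := by
  rcases le_or_gt 0 u with hu | hu
  · rw [abs_of_nonneg hu]
  · rw [abs_of_neg hu]
    have : ((c : ℂ) + u * I) / 2 = (starRingEnd ℂ) (((c : ℂ) + ((-u : ℝ) : ℂ) * I) / 2) := by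
      simp only [map_div₀, map_add, Complex.conj_ofReal, map_mul, Complex.conj_I, map_ofNat]
      push_cast; ring
    rw [this, Complex.Gamma_conj, Complex.norm_conj]

/-- `y ↦ y/(a² + y²)` increases on `[0, a]` … [folklore] -/
private theorem div_sq_add_sq_mono {a y y' : ℝ} (hy : 0 < y) (hyy' : y ≤ y') (ha : y' ≤ a) :
    y / (a ^ 2 + y ^ 2) ≤ y' / (a ^ 2 + y' ^ 2) := by
  have hy' : 0 < y' := hy.trans_le hyy'
  rw [div_le_div_iff₀ (by positivity) (by positivity)]
  nlinarith [mul_nonneg (sub_nonneg.2 hyy') (sub_nonneg.2 (mul_le_mul ha (hyy'.trans ha) hy.le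
    (hy.le.trans (hyy'.trans ha)))), hy]

/-- … and decreases on `[a, ∞)`. [folklore] -/
private theorem div_sq_add_sq_anti {a y y' : ℝ} (ha0 : 0 < a) (ha : a ≤ y) (hyy' : y ≤ y') :
    y' / (a ^ 2 + y' ^ 2) ≤ y / (a ^ 2 + y ^ 2) := by
  have hy : 0 < y := ha0.trans_le ha
  rw [div_le_div_iff₀ (by positivity) (by positivity)]
  nlinarith [mul_nonneg (sub_nonneg.2 hyy') (sub_nonneg.2 (mul_le_mul ha (ha.trans hyy') ha0.le
    hy.le)), hy]

/-- Four terms of the series for `Im ψ(x + iy)` on a cell `y ∈ [y₁, y₂]`, `x ≤ y₁`, `y₂ ≤ x + 1`.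
[folklore] -/
private theorem im_digamma_ge_cell {x y y₁ y₂ : ℝ} (hx : 0 < x) (h1 : x ≤ y₁) (h2 : y₁ ≤ y)
    (h3 : y ≤ y₂) (h4 : y₂ ≤ x + 1) :
    y₂ / (x ^ 2 + y₂ ^ 2) + y₁ / ((x + 1) ^ 2 + y₁ ^ 2) + y₁ / ((x + 2) ^ 2 + y₁ ^ 2) +
        y₁ / ((x + 3) ^ 2 + y₁ ^ 2) ≤ (Complex.digamma (x + y * I)).im := by
  have hy₁ : 0 < y₁ := hx.trans_le h1
  have hy : 0 < y := hy₁.trans_le h2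
  have hs := sum_le_im_digamma (w := x + y * I) (by simp; exact hx) (by simp; exact hy.le) 4
  simp only [Finset.sum_range_succ, Finset.sum_range_zero, zero_add, Complex.add_re,
    Complex.ofReal_re, Complex.mul_re, Complex.I_re, mul_zero, Complex.ofReal_im, Complex.I_im,
    mul_one, sub_self, add_zero, Complex.add_im, Complex.mul_im, zero_add, Nat.cast_zero,
    Nat.cast_one, Nat.cast_ofNat] at hs
  have t0 : y₂ / (x ^ 2 + y₂ ^ 2) ≤ y / (x ^ 2 + y ^ 2) := div_sq_add_sq_anti hx (h1.trans h2) h3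
  have t1 : y₁ / ((x + 1) ^ 2 + y₁ ^ 2) ≤ y / ((x + 1) ^ 2 + y ^ 2) :=
    div_sq_add_sq_mono hy₁ h2 (by linarith)
  have t2 : y₁ / ((x + 2) ^ 2 + y₁ ^ 2) ≤ y / ((x + 2) ^ 2 + y ^ 2) :=
    div_sq_add_sq_mono hy₁ h2 (by linarith)
  have t3 : y₁ / ((x + 3) ^ 2 + y₁ ^ 2) ≤ y / ((x + 3) ^ 2 + y ^ 2) :=
    div_sq_add_sq_mono hy₁ h2 (by linarith)
  have e0 : x ^ 2 + y ^ 2 = (x + 0) ^ 2 + y ^ 2 := by ring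
  linarith

/-- **Stirling to second order as a lower bound for `Im ψ`:** for `x > 0`,
`Im ψ(x+iy) ≥ arg(x+iy) + y/(2(x²+y²)) + xy/(6(x²+y²)²) − (√3π/144)/‖x+iy‖³`
(imaginary part of `ψ(w) = Log w − 1/(2w) − 1/(12w²) + Θ(√3π/(144|w|³))`, the tree's
`DigammaLehman.norm_digamma_sub_stirling_two_le`). [cite: WhittakerWatson1927, §12.33] [cite: DLMF, Eq. 5.11.2] -/
theorem stirling_le_im_digamma {x y : ℝ} (hx : 0 < x) :
    Complex.arg (x + y * I) + y / (2 * (x ^ 2 + y ^ 2)) + x * y / (6 * (x ^ 2 + y ^ 2) ^ 2) -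
        Real.sqrt 3 * π / 144 / ‖(x : ℂ) + y * I‖ ^ 3 ≤ (Complex.digamma (x + y * I)).im := by
  set w : ℂ := x + y * I with hw
  have hwre : w.re = x := by simp [hw]
  have hwim : w.im = y := by simp [hw]
  have hw0 : 0 < w.re := by rw [hwre]; exact hx
  have hne : (x : ℂ) + y * I ≠ 0 := fun h0 => by
    have := congrArg Complex.re h0; simp at this; linarith
  have h := Literature.Analysis.SpecialFunctions.DigammaLehman.norm_digamma_sub_stirling_two_le hw0
  have him : (Complex.log w - 1 / (2 * w) - 1 / (12 * w ^ 2)).im =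
      Complex.arg w + y / (2 * (x ^ 2 + y ^ 2)) + x * y / (6 * (x ^ 2 + y ^ 2) ^ 2) := by
    have hn : Complex.normSq w = x ^ 2 + y ^ 2 := by rw [Complex.normSq_apply, hwre, hwim]; ring
    have hn0 : x ^ 2 + y ^ 2 ≠ 0 := by positivity
    have e1 : (1 / (2 * w)).im = -(y / (2 * (x ^ 2 + y ^ 2))) := by
      rw [one_div, Complex.inv_im, Complex.normSq_mul, hn]
      have : (2 * w).im = 2 * y := by simp [hwim]
      rw [this, show Complex.normSq (2 : ℂ) = 4 by simp; norm_num]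
      field_simp
      ring
    have e2 : (1 / (12 * w ^ 2)).im = -(x * y / (6 * (x ^ 2 + y ^ 2) ^ 2)) := by
      rw [one_div, Complex.inv_im, Complex.normSq_mul, map_pow, hn]
      have : (12 * w ^ 2).im = 24 * x * y := by
        rw [hw]; simp [sq]; ring
      rw [this, show Complex.normSq (12 : ℂ) = 144 by simp; norm_num]
      field_simp
      ring
    rw [Complex.sub_im, Complex.sub_im, Complex.log_im, e1, e2]
    ring
  have h2 := (Complex.abs_im_le_norm (Complex.digamma w - (Complex.log w - 1 / (2 * w) - 1 / (12 * w ^ 2)))).trans h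
  rw [Complex.sub_im, him] at h2
  have := (abs_le.mp h2).1
  rw [hw] at this ⊢
  linarith

/-! ## §2 Booker's rate: `β(t) ≤ ½ Im ψ((c+iτ)/2) − τ/(2(c²+τ²))` -/

/-- Booker's step verbatim (degree one): for `τ > c > 0`,
`π/4 − ½arctan(c/τ) − 4/(π²(τ²−c²)) ≤ ½ Im ψ((c+iτ)/2) − τ/(2(c²+τ²))` — Lehman's (4.3) with the
`−1/(2z)` terms of `γ'/γ` and `½ Q'/Q` cancelling exactly. [cite: Booker2006, proof of Lemma 5.7] -/
theorem lehman_route {c τ : ℝ} (hc : 0 < c) (hcτ : c < τ) :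
    π / 4 - 1 / 2 * Real.arctan (c / τ) - 4 / (π ^ 2 * (τ ^ 2 - c ^ 2)) ≤
      1 / 2 * (Complex.digamma (((c : ℂ) + τ * I) / 2)).im - τ / (2 * (c ^ 2 + τ ^ 2)) := by
  have hτ : 0 < τ := hc.trans hcτ
  have h := lehman_le_im_digamma (x := c / 2) (y := τ / 2) (by positivity) (by linarith)
  have e0 := half_arg c τ
  rw [← e0] at h
  have e1 : c / 2 / (τ / 2) = c / τ := by field_simp
  have e2 : τ / 2 / (2 * ((c / 2) ^ 2 + (τ / 2) ^ 2)) = τ / (c ^ 2 + τ ^ 2) := by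
    rw [div_div]; congr 1; ring
  have e3 : 2 / (π ^ 2 * ((τ / 2) ^ 2 - (c / 2) ^ 2)) = 8 / (π ^ 2 * (τ ^ 2 - c ^ 2)) := by
    field_simp; ring
  rw [e1, e2, e3] at h
  have e4 : τ / (2 * (c ^ 2 + τ ^ 2)) = 1 / 2 * (τ / (c ^ 2 + τ ^ 2)) := by field_simp
  have e5 : 4 / (π ^ 2 * (τ ^ 2 - c ^ 2)) = 1 / 2 * (8 / (π ^ 2 * (τ ^ 2 - c ^ 2))) := by ring
  rw [e4, e5]
  linarith

/-- Positivity of Booker's rate: `0 < τ/(2(c²+τ²)) ≤ ½ Im ψ((c+iτ)/2) − τ/(2(c²+τ²))` for `c, τ > 0`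
(first term of the series for `Im ψ`). [folklore] -/
private theorem rate_pos {c τ : ℝ} (hc : 0 < c) (hτ : 0 < τ) :
    τ / (2 * (c ^ 2 + τ ^ 2)) ≤
      1 / 2 * (Complex.digamma (((c : ℂ) + τ * I) / 2)).im - τ / (2 * (c ^ 2 + τ ^ 2)) := by
  have hs := sum_le_im_digamma (w := ((c / 2 : ℝ) : ℂ) + ((τ / 2 : ℝ) : ℂ) * I)
    (by simp; positivity) (by simp; positivity) 1
  simp only [Finset.sum_range_succ, Finset.sum_range_zero, zero_add, Complex.add_re,
    Complex.ofReal_re, Complex.mul_re, Complex.I_re, mul_zero, Complex.ofReal_im, Complex.I_im,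
    mul_one, sub_self, add_zero, Complex.add_im, Complex.mul_im, Nat.cast_zero] at hs
  have e : τ / 2 / ((c / 2) ^ 2 + (τ / 2) ^ 2) = 2 * τ / (c ^ 2 + τ ^ 2) := by
    rw [div_div, div_eq_div_iff (by positivity) (by positivity)]; ring
  rw [e, ← half_arg] at hs
  have e2 : τ / (2 * (c ^ 2 + τ ^ 2)) = 1 / 4 * (2 * τ / (c ^ 2 + τ ^ 2)) := by
    field_simp; ring
  rw [e2]
  linarith

/-- Booker's `β` is negative on `0 < t < ½` in the even case (`4/(π²(¼ − t²)) ≥ 16/π² > π/4`).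
[folklore] -/
private theorem beta_even_neg {t : ℝ} (ht : 0 < t) (ht2 : t < 1 / 2) :
    π / 4 - 1 / 2 * Real.arctan ((1 / 2) / t) - 4 / (π ^ 2 * |t ^ 2 - (1 / 2) ^ 2|) < 0 := by
  have hπ := Real.pi_lt_d2
  have hπ0 := Real.pi_pos
  have ha : 0 ≤ Real.arctan ((1 / 2) / t) := by
    rw [← Real.arctan_zero]; exact Real.arctan_strictMono.monotone (by positivity)
  have hd : 0 < (1 / 2) ^ 2 - t ^ 2 := by nlinarith
  rw [abs_of_neg (by linarith), neg_sub]
  have h16 : 16 / π ^ 2 ≤ 4 / (π ^ 2 * ((1 / 2) ^ 2 - t ^ 2)) := by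
    rw [div_le_div_iff₀ (by positivity) (by positivity)]
    nlinarith [sq_nonneg t, hπ0]
  have h16' : (8 / 5 : ℝ) ≤ 16 / π ^ 2 := by
    rw [le_div_iff₀ (by positivity)]; nlinarith
  linarith

/-- One cell of the verification that Booker's `β` is negative on `(0, 3/2)` in the odd case:
`arctan(3/(2t)) = π/2 − arctan(2t/3) ≥ π/2 − P(2t₂/3)` (`P(w) = w − w³/3 + w⁵/5`),
`9/4 − t² ≤ 9/4 − t₁²`, `π² < 9.8697`. [folklore] -/
private theorem cell {t t₁ t₂ : ℝ} (ht : 0 < t) (h1 : t₁ ≤ t) (h2 : t ≤ t₂) (hlt : t < 3 / 2)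
    (ht1 : 0 ≤ t₁) (ht2 : 0 < t₂)
    (hnum : 98697 / 10000 * (2 * t₂ / 3 - (2 * t₂ / 3) ^ 3 / 3 + (2 * t₂ / 3) ^ 5 / 5) *
      ((3 / 2) ^ 2 - t₁ ^ 2) < 8) :
    π / 4 - 1 / 2 * Real.arctan ((3 / 2) / t) - 4 / (π ^ 2 * |t ^ 2 - (3 / 2) ^ 2|) < 0 := by
  have hπ := Real.pi_lt_d4
  have hπ' := Real.pi_gt_d2
  have hπ2 : π ^ 2 < 98697 / 10000 := by nlinarith
  have hd : 0 < (3 / 2) ^ 2 - t ^ 2 := by nlinarith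
  rw [abs_of_neg (by linarith), neg_sub]
  set w : ℝ := 2 * t₂ / 3 with hw
  have hw0 : 0 < w := by rw [hw]; positivity
  have hP0 : 0 ≤ w - w ^ 3 / 3 + w ^ 5 / 5 := by
    have := arctan_le_poly5 hw0.le
    have h0 : 0 ≤ Real.arctan w := by
      rw [← Real.arctan_zero]; exact Real.arctan_strictMono.monotone hw0.le
    linarith
  -- arctan(3/2/t) ≥ arctan(3/2/t₂) = π/2 - arctan w ≥ π/2 - P(w)
  have ha1 : Real.arctan ((3 / 2) / t₂) ≤ Real.arctan ((3 / 2) / t) :=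
    Real.arctan_strictMono.monotone (div_le_div_of_nonneg_left (by norm_num) ht h2)
  have ha2 : Real.arctan ((3 / 2) / t₂) = π / 2 - Real.arctan w := by
    rw [show (3 / 2 : ℝ) / t₂ = w⁻¹ by rw [hw]; field_simp, Real.arctan_inv_of_pos hw0]
  have ha3 := arctan_le_poly5 hw0.le
  -- second term
  have hd1 : (3 / 2) ^ 2 - t ^ 2 ≤ (3 / 2) ^ 2 - t₁ ^ 2 := by nlinarith
  have hq : 4 / (98697 / 10000 * ((3 / 2) ^ 2 - t₁ ^ 2)) ≤ 4 / (π ^ 2 * ((3 / 2) ^ 2 - t ^ 2)) := by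
    apply div_le_div_of_nonneg_left (by norm_num) (by positivity)
    exact mul_le_mul hπ2.le hd1 hd.le (by norm_num)
  have hd0 : 0 < (3 / 2) ^ 2 - t₁ ^ 2 := by linarith
  have key : 1 / 2 * (w - w ^ 3 / 3 + w ^ 5 / 5) < 4 / (98697 / 10000 * ((3 / 2) ^ 2 - t₁ ^ 2)) := by
    rw [lt_div_iff₀ (by positivity)]; nlinarith
  linarith

/-- Booker's `β` is negative on `0 < t < 3/2` in the odd case (seventeen cells; the margin is `0.0067`
near `t = 0.81`). [folklore] -/
private theorem beta_odd_neg {t : ℝ} (ht : 0 < t) (ht2 : t < 3 / 2) :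
    π / 4 - 1 / 2 * Real.arctan ((3 / 2) / t) - 4 / (π ^ 2 * |t ^ 2 - (3 / 2) ^ 2|) < 0 := by
  rcases le_or_gt t (14 / 25 : ℝ) with h0 | h0
  · exact cell (t₁ := 0) (t₂ := 14 / 25) ht (by linarith) h0 ht2 (by norm_num) (by norm_num)
      (by norm_num)
  rcases le_or_gt t (33 / 50 : ℝ) with h1 | h1
  · exact cell (t₁ := 14 / 25) (t₂ := 33 / 50) ht (by linarith) h1 ht2 (by norm_num) (by norm_num)
      (by norm_num)
  rcases le_or_gt t (71 / 100 : ℝ) with h2 | h2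
  · exact cell (t₁ := 33 / 50) (t₂ := 71 / 100) ht (by linarith) h2 ht2 (by norm_num) (by norm_num)
      (by norm_num)
  rcases le_or_gt t (37 / 50 : ℝ) with h3 | h3
  · exact cell (t₁ := 71 / 100) (t₂ := 37 / 50) ht (by linarith) h3 ht2 (by norm_num) (by norm_num)
      (by norm_num)
  rcases le_or_gt t (77 / 100 : ℝ) with h4 | h4
  · exact cell (t₁ := 37 / 50) (t₂ := 77 / 100) ht (by linarith) h4 ht2 (by norm_num) (by norm_num)
      (by norm_num)
  rcases le_or_gt t (79 / 100 : ℝ) with h5 | h5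
  · exact cell (t₁ := 77 / 100) (t₂ := 79 / 100) ht (by linarith) h5 ht2 (by norm_num) (by norm_num)
      (by norm_num)
  rcases le_or_gt t (81 / 100 : ℝ) with h6 | h6
  · exact cell (t₁ := 79 / 100) (t₂ := 81 / 100) ht (by linarith) h6 ht2 (by norm_num) (by norm_num)
      (by norm_num)
  rcases le_or_gt t (83 / 100 : ℝ) with h7 | h7
  · exact cell (t₁ := 81 / 100) (t₂ := 83 / 100) ht (by linarith) h7 ht2 (by norm_num) (by norm_num)
      (by norm_num)
  rcases le_or_gt t (17 / 20 : ℝ) with h8 | h8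
  · exact cell (t₁ := 83 / 100) (t₂ := 17 / 20) ht (by linarith) h8 ht2 (by norm_num) (by norm_num)
      (by norm_num)
  rcases le_or_gt t (87 / 100 : ℝ) with h9 | h9
  · exact cell (t₁ := 17 / 20) (t₂ := 87 / 100) ht (by linarith) h9 ht2 (by norm_num) (by norm_num)
      (by norm_num)
  rcases le_or_gt t (89 / 100 : ℝ) with h10 | h10
  · exact cell (t₁ := 87 / 100) (t₂ := 89 / 100) ht (by linarith) h10 ht2 (by norm_num) (by norm_num)
      (by norm_num)
  rcases le_or_gt t (23 / 25 : ℝ) with h11 | h11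
  · exact cell (t₁ := 89 / 100) (t₂ := 23 / 25) ht (by linarith) h11 ht2 (by norm_num) (by norm_num)
      (by norm_num)
  rcases le_or_gt t (24 / 25 : ℝ) with h12 | h12
  · exact cell (t₁ := 23 / 25) (t₂ := 24 / 25) ht (by linarith) h12 ht2 (by norm_num) (by norm_num)
      (by norm_num)
  rcases le_or_gt t (103 / 100 : ℝ) with h13 | h13
  · exact cell (t₁ := 24 / 25) (t₂ := 103 / 100) ht (by linarith) h13 ht2 (by norm_num) (by norm_num)
      (by norm_num)
  rcases le_or_gt t (117 / 100 : ℝ) with h14 | h14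
  · exact cell (t₁ := 103 / 100) (t₂ := 117 / 100) ht (by linarith) h14 ht2 (by norm_num) (by norm_num)
      (by norm_num)
  rcases le_or_gt t (149 / 100 : ℝ) with h15 | h15
  · exact cell (t₁ := 117 / 100) (t₂ := 149 / 100) ht (by linarith) h15 ht2 (by norm_num) (by norm_num)
      (by norm_num)
  exact cell (t₁ := 149 / 100) (t₂ := 3 / 2) ht (by linarith) ht2.le ht2 (by norm_num) (by norm_num)
      (by norm_num)

/-- The junk value at `t = ½` (even case; Lean's `4/0 = 0` makes `β(½) = π/8`):
`π/8 ≤ ½ Im ψ((½+iτ)/2) − τ/(2(¼+τ²))` for `τ ≥ ½`. [folklore] -/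
private theorem rate_even_half {τ : ℝ} (hτ : 1 / 2 ≤ τ) :
    π / 8 ≤ 1 / 2 * (Complex.digamma ((((1 / 2 : ℝ) : ℂ) + τ * I) / 2)).im -
      τ / (2 * ((1 / 2) ^ 2 + τ ^ 2)) := by
  have hπ := Real.pi_lt_d2
  have hπ' := Real.pi_gt_d2
  rcases le_or_gt (9 / 5 : ℝ) τ with h | h
  · have hL := lehman_route (c := 1 / 2) (τ := τ) (by norm_num) (by linarith)
    have hm := booker_rate_mono (c := 1 / 2) (t := 9 / 5) (τ := τ) (by norm_num) (by norm_num) h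
    have ha : Real.arctan (1 / 2 / (9 / 5) : ℝ) ≤ 1 / 2 / (9 / 5) := arctan_le_self (by norm_num)
    have hπ2 : (3.14 : ℝ) ^ 2 < π ^ 2 := by nlinarith
    have hq : 4 / (π ^ 2 * ((9 / 5 : ℝ) ^ 2 - (1 / 2) ^ 2)) ≤
        4 / (3.14 ^ 2 * ((9 / 5 : ℝ) ^ 2 - (1 / 2) ^ 2)) := by
      apply div_le_div_of_nonneg_left (by norm_num) (by positivity)
      exact mul_le_mul_of_nonneg_right hπ2.le (by norm_num)
    have : π / 8 ≤ π / 4 - 1 / 2 * (1 / 2 / (9 / 5)) - 4 / (3.14 ^ 2 * ((9 / 5 : ℝ) ^ 2 - (1 / 2) ^ 2)) := by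
      norm_num; nlinarith
    linarith
  · have hsub : ∀ τ₁ : ℝ, 1 / 2 ≤ τ₁ → τ₁ ≤ τ →
        τ / (2 * ((1 / 2) ^ 2 + τ ^ 2)) ≤ τ₁ / (2 * ((1 / 2) ^ 2 + τ₁ ^ 2)) := by
      intro τ₁ h1 h2
      have := div_sq_add_sq_anti (a := 1 / 2) (y := τ₁) (y' := τ) (by norm_num) h1 h2
      rw [mul_comm 2 ((1 / 2 : ℝ) ^ 2 + τ ^ 2), mul_comm 2 ((1 / 2 : ℝ) ^ 2 + τ₁ ^ 2), ← div_div, ← div_div]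
      linarith
    rw [half_arg]
    rcases le_or_gt τ 1 with h1 | h1
    · have hc := im_digamma_ge_cell (x := 1 / 2 / 2) (y := τ / 2) (y₁ := 1 / 4) (y₂ := 1 / 2)
        (by norm_num) (by norm_num) (by linarith) (by linarith) (by norm_num)
      have hs := hsub (1 / 2) le_rfl hτ
      norm_num at hc hs ⊢
      nlinarith
    rcases le_or_gt τ (7 / 5) with h2 | h2
    · have hc := im_digamma_ge_cell (x := 1 / 2 / 2) (y := τ / 2) (y₁ := 1 / 2) (y₂ := 7 / 10)
        (by norm_num) (by norm_num) (by linarith) (by linarith) (by norm_num)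
      have hs := hsub 1 (by norm_num) h1.le
      norm_num at hc hs ⊢
      nlinarith
    · have hc := im_digamma_ge_cell (x := 1 / 2 / 2) (y := τ / 2) (y₁ := 7 / 10) (y₂ := 9 / 10)
        (by norm_num) (by norm_num) (by linarith) (by linarith) (by norm_num)
      have hs := hsub (7 / 5) (by norm_num) h2.le
      norm_num at hc hs ⊢
      nlinarith

/-- The argument of `x + iy`, `x > 0`: `arg (x + iy) = arctan (y/x)`. [folklore] -/
private theorem arg_eq_arctan {x y : ℝ} (hx : 0 < x) :
    Complex.arg (x + y * I) = Real.arctan (y / x) := by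
  have hre : (x + y * I : ℂ).re = x := by simp
  have him : (x + y * I : ℂ).im = y := by simp
  have ht : Real.tan (Complex.arg (x + y * I)) = y / x := by rw [Complex.tan_arg, him, hre]
  have hlt : |Complex.arg (x + y * I)| < π / 2 :=
    Complex.abs_arg_lt_pi_div_two_iff.mpr (Or.inl (by rw [hre]; exact hx))
  rw [abs_lt] at hlt
  rw [← ht, Real.arctan_tan hlt.1 hlt.2]

/-- One Stirling cell for the odd junk value: on `τ ∈ [τ₁, τ₂]`, `3/2 ≤ τ₁`,
`½ Im ψ(3/4 + iτ/2) − τ/(2(9/4+τ²)) ≥ ½(arg(3/4 + iτ₁/2) + 4τ₂/(9+4τ₂²) + 16τ₁/(9+4τ₂²)² − Err) − 2τ₁/(9+4τ₁²)`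
with `Err = 0.0378/(m((3/4)² + (τ₁/2)²))`, `0 < m ≤ |3/4 + iτ₁/2|`. [folklore] -/
private theorem stirling_cell {τ τ₁ τ₂ m : ℝ} (h15 : 3 / 2 ≤ τ₁) (h1 : τ₁ ≤ τ) (h2 : τ ≤ τ₂)
    (hm : 0 < m) (hm2 : m ^ 2 ≤ (3 / 4) ^ 2 + (τ₁ / 2) ^ 2) :
    1 / 2 * (Complex.arg ((3 / 4 : ℝ) + (τ₁ / 2 : ℝ) * I) + 4 * τ₂ / (9 + 4 * τ₂ ^ 2) +
        16 * τ₁ / (9 + 4 * τ₂ ^ 2) ^ 2 - 378 / 10000 / (m * ((3 / 4) ^ 2 + (τ₁ / 2) ^ 2))) -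
        2 * τ₁ / (9 + 4 * τ₁ ^ 2) ≤
      1 / 2 * (Complex.digamma ((((3 / 2 : ℝ) : ℂ) + τ * I) / 2)).im -
        τ / (2 * ((3 / 2) ^ 2 + τ ^ 2)) := by
  have hτ : 3 / 2 ≤ τ := h15.trans h1
  have hτ0 : 0 < τ := by linarith
  have hτ1 : 0 < τ₁ := by linarith
  have hst := stirling_le_im_digamma (x := 3 / 4) (y := τ / 2) (by norm_num)
  rw [half_arg, show ((3 / 2 : ℝ) / 2) = 3 / 4 by norm_num]
  -- (a) the argument is increasing in `τ`
  have harg : Complex.arg ((3 / 4 : ℝ) + (τ₁ / 2 : ℝ) * I) ≤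
      Complex.arg ((3 / 4 : ℝ) + (τ / 2 : ℝ) * I) := by
    rw [arg_eq_arctan (by norm_num), arg_eq_arctan (by norm_num)]
    exact Real.arctan_strictMono.monotone (by
      rw [div_le_div_iff_of_pos_right (by norm_num)]; linarith)
  -- (b) `A₂` decreasing on `[3/2, ∞)`
  have hA2 : 4 * τ₂ / (9 + 4 * τ₂ ^ 2) ≤ τ / 2 / (2 * ((3 / 4) ^ 2 + (τ / 2) ^ 2)) := by
    rw [show τ / 2 / (2 * ((3 / 4 : ℝ) ^ 2 + (τ / 2) ^ 2)) = 4 * τ / (9 + 4 * τ ^ 2) by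
      field_simp; ring]
    rw [div_le_div_iff₀ (by positivity) (by positivity)]
    nlinarith [mul_nonneg (sub_nonneg.2 h2) (by nlinarith : (0 : ℝ) ≤ 4 * τ * τ₂ - 9)]
  -- (c) `A₃`, crude monotone bound
  have hA3 : 16 * τ₁ / (9 + 4 * τ₂ ^ 2) ^ 2 ≤
      3 / 4 * (τ / 2) / (6 * ((3 / 4) ^ 2 + (τ / 2) ^ 2) ^ 2) := by
    rw [show 3 / 4 * (τ / 2) / (6 * ((3 / 4 : ℝ) ^ 2 + (τ / 2) ^ 2) ^ 2) =
      16 * τ / (9 + 4 * τ ^ 2) ^ 2 by field_simp; ring]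
    have hden : (9 + 4 * τ ^ 2) ^ 2 ≤ (9 + 4 * τ₂ ^ 2) ^ 2 := by
      apply pow_le_pow_left₀ (by positivity); nlinarith
    calc 16 * τ₁ / (9 + 4 * τ₂ ^ 2) ^ 2 ≤ 16 * τ / (9 + 4 * τ₂ ^ 2) ^ 2 := by gcongr
      _ ≤ 16 * τ / (9 + 4 * τ ^ 2) ^ 2 :=
          div_le_div_of_nonneg_left (by positivity) (by positivity) hden
  -- (d) the error term
  have hn2 : ‖((3 / 4 : ℝ) : ℂ) + ((τ / 2 : ℝ) : ℂ) * I‖ ^ 2 = (3 / 4) ^ 2 + (τ / 2) ^ 2 := by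
    rw [Complex.sq_norm, Complex.normSq_apply]; simp; ring
  have hz0 : 0 ≤ ‖((3 / 4 : ℝ) : ℂ) + ((τ / 2 : ℝ) : ℂ) * I‖ := norm_nonneg _
  have hz1 : (3 / 4 : ℝ) ^ 2 + (τ₁ / 2) ^ 2 ≤ ‖((3 / 4 : ℝ) : ℂ) + ((τ / 2 : ℝ) : ℂ) * I‖ ^ 2 := by
    rw [hn2]; nlinarith
  have hmz : m ≤ ‖((3 / 4 : ℝ) : ℂ) + ((τ / 2 : ℝ) : ℂ) * I‖ :=
    (pow_le_pow_iff_left₀ hm.le hz0 two_ne_zero).mp (hm2.trans hz1)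
  have hnorm_ge : m * ((3 / 4) ^ 2 + (τ₁ / 2) ^ 2) ≤ ‖((3 / 4 : ℝ) : ℂ) + ((τ / 2 : ℝ) : ℂ) * I‖ ^ 3 := by
    calc m * ((3 / 4) ^ 2 + (τ₁ / 2) ^ 2)
        ≤ ‖((3 / 4 : ℝ) : ℂ) + ((τ / 2 : ℝ) : ℂ) * I‖ * ‖((3 / 4 : ℝ) : ℂ) + ((τ / 2 : ℝ) : ℂ) * I‖ ^ 2 :=
          mul_le_mul hmz hz1 (by positivity) hz0
      _ = _ := by ring
  have h3 : Real.sqrt 3 ≤ 17321 / 10000 := by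
    rw [show (17321 / 10000 : ℝ) = Real.sqrt ((17321 / 10000) ^ 2) by
      rw [Real.sqrt_sq (by norm_num)]]
    exact Real.sqrt_le_sqrt (by norm_num)
  have hπ := Real.pi_lt_d4
  have hnum : Real.sqrt 3 * π / 144 ≤ 378 / 10000 := by
    rw [div_le_iff₀ (by norm_num)]
    nlinarith [Real.sqrt_nonneg 3, Real.pi_pos]
  have herr : Real.sqrt 3 * π / 144 / ‖((3 / 4 : ℝ) : ℂ) + ((τ / 2 : ℝ) : ℂ) * I‖ ^ 3 ≤
      378 / 10000 / (m * ((3 / 4) ^ 2 + (τ₁ / 2) ^ 2)) :=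
    div_le_div₀ (by norm_num) hnum (by positivity) hnorm_ge
  -- (e) `S` decreasing on `[3/2, ∞)`
  have hS : τ / (2 * ((3 / 2) ^ 2 + τ ^ 2)) ≤ 2 * τ₁ / (9 + 4 * τ₁ ^ 2) := by
    rw [show τ / (2 * ((3 / 2 : ℝ) ^ 2 + τ ^ 2)) = 2 * τ / (9 + 4 * τ ^ 2) by field_simp; ring]
    rw [div_le_div_iff₀ (by positivity) (by positivity)]
    nlinarith [mul_nonneg (sub_nonneg.2 h1) (by nlinarith : (0 : ℝ) ≤ 4 * τ * τ₁ - 9)]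
  linarith

/-- The junk value at `t = 3/2` (odd case; `β(3/2) = π/8` in Lean):
`π/8 ≤ ½ Im ψ((3/2+iτ)/2) − τ/(2(9/4+τ²))` for `τ ≥ 3/2` (four Stirling cells on `[3/2, 3]`, Lehman beyond).
[folklore] -/
private theorem rate_odd_three_halves {τ : ℝ} (hτ : 3 / 2 ≤ τ) :
    π / 8 ≤ 1 / 2 * (Complex.digamma ((((3 / 2 : ℝ) : ℂ) + τ * I) / 2)).im -
      τ / (2 * ((3 / 2) ^ 2 + τ ^ 2)) := by
  have hπ := Real.pi_lt_d4
  have hπ' := Real.pi_gt_d4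
  rcases le_or_gt (3 : ℝ) τ with h | h
  · have hL := lehman_route (c := 3 / 2) (τ := τ) (by norm_num) (by linarith)
    have hm := booker_rate_mono (c := 3 / 2) (t := 3) (τ := τ) (by norm_num) (by norm_num) h
    have ha : Real.arctan (3 / 2 / 3 : ℝ) ≤ 3 / 2 / 3 := arctan_le_self (by norm_num)
    have hπ2 : (3.14 : ℝ) ^ 2 < π ^ 2 := by nlinarith
    have hq : 4 / (π ^ 2 * ((3 : ℝ) ^ 2 - (3 / 2) ^ 2)) ≤ 4 / (3.14 ^ 2 * ((3 : ℝ) ^ 2 - (3 / 2) ^ 2)) := by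
      apply div_le_div_of_nonneg_left (by norm_num) (by positivity)
      exact mul_le_mul_of_nonneg_right hπ2.le (by norm_num)
    have : π / 8 ≤ π / 4 - 1 / 2 * (3 / 2 / 3) - 4 / (3.14 ^ 2 * ((3 : ℝ) ^ 2 - (3 / 2) ^ 2)) := by
      norm_num; nlinarith
    linarith
  -- arg lower bounds: `arg(3/4 + iτ₁/2) = π/2 − arctan(3/(2τ₁)) ≥ π/2 − P(3/(2τ₁))`
  have harglb : ∀ τ₁ : ℝ, 0 < τ₁ → π / 2 - (3 / (2 * τ₁) - (3 / (2 * τ₁)) ^ 3 / 3 + (3 / (2 * τ₁)) ^ 5 / 5) ≤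
      Complex.arg ((3 / 4 : ℝ) + (τ₁ / 2 : ℝ) * I) := by
    intro τ₁ h0
    rw [arg_eq_arctan (by norm_num), show (τ₁ / 2) / (3 / 4 : ℝ) = (3 / (2 * τ₁))⁻¹ by
        rw [inv_div, div_div_eq_mul_div, div_eq_div_iff (by norm_num) (by norm_num)]; ring,
      Real.arctan_inv_of_pos (by positivity)]
    have := arctan_le_poly5 (w := 3 / (2 * τ₁)) (by positivity)
    linarith
  rcases le_or_gt τ (17 / 10) with h1 | h1
  · have hc := stirling_cell (τ₁ := 3 / 2) (τ₂ := 17 / 10) (m := 106 / 100) le_rfl hτ h1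
      (by norm_num) (by norm_num)
    have ha : Complex.arg ((3 / 4 : ℝ) + ((3 / 2 : ℝ) / 2 : ℝ) * I) = π / 4 := by
      rw [arg_eq_arctan (by norm_num), show ((3 / 2 : ℝ) / 2) / (3 / 4 : ℝ) = 1 by norm_num,
        Real.arctan_one]
    rw [ha] at hc
    norm_num at hc ⊢
    nlinarith
  rcases le_or_gt τ 2 with h2 | h2
  · have hc := stirling_cell (τ₁ := 17 / 10) (τ₂ := 2) (m := 1133 / 1000) (by norm_num) h1.le h2
      (by norm_num) (by norm_num)
    have ha := harglb (17 / 10) (by norm_num)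
    norm_num at hc ha ⊢
    nlinarith
  rcases le_or_gt τ (5 / 2) with h3 | h3
  · have hc := stirling_cell (τ₁ := 2) (τ₂ := 5 / 2) (m := 5 / 4) (by norm_num) h2.le h3
      (by norm_num) (by norm_num)
    have ha := harglb 2 (by norm_num)
    norm_num at hc ha ⊢
    nlinarith
  · have hc := stirling_cell (τ₁ := 5 / 2) (τ₂ := 3) (m := 145 / 100) (by norm_num) h3.le h.le
      (by norm_num) (by norm_num)
    have ha := harglb (5 / 2) (by norm_num)
    norm_num at hc ha ⊢
    nlinarith

/-- **Booker's rate inequality, degree one, with Booker's `β`:** for `c ∈ {½, 3/2}` and `0 < t ≤ τ`,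
`π/4 − ½arctan(c/t) − 4/(π²|t² − c²|) ≤ ½ Im ψ((c+iτ)/2) − τ/(2(c²+τ²))` — per unit length, the step
"`−kB Im(γ'/γ + ½Q'/Q)(s*) ≤ … ≤ −βkB`" of the printed proof (for `t > c` verbatim: Lehman's (4.3) and
monotonicity; the range `t < c`, where the printed monotonicity step does not apply, by `β < 0` against
the first series term; Lean's `4/0 = 0` junk values at `t = c` included). [cite: Booker2006, proof of Lemma 5.7] -/
theorem rate {c : ℝ} (hc : c = 1 / 2 ∨ c = 3 / 2) {t τ : ℝ} (ht : 0 < t) (htτ : t ≤ τ) :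
    π / 4 - 1 / 2 * Real.arctan (c / t) - 4 / (π ^ 2 * |t ^ 2 - c ^ 2|) ≤
      1 / 2 * (Complex.digamma (((c : ℂ) + τ * I) / 2)).im - τ / (2 * (c ^ 2 + τ ^ 2)) := by
  have hτ : 0 < τ := ht.trans_le htτ
  have hc0 : 0 < c := by rcases hc with rfl | rfl <;> norm_num
  rcases lt_trichotomy c t with hct | hct | hct
  · have hL := lehman_route hc0 (hct.trans_le htτ)
    have hm := booker_rate_mono hc0 hct htτ
    rw [abs_of_pos (by nlinarith : 0 < t ^ 2 - c ^ 2)]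
    linarith
  · subst hct
    rw [sub_self, abs_zero, mul_zero, div_zero, sub_zero, div_self hc0.ne', Real.arctan_one,
      show π / 4 - 1 / 2 * (π / 4) = π / 8 by ring]
    rcases hc with rfl | rfl
    · simpa using rate_even_half htτ
    · simpa using rate_odd_three_halves htτ
  · have hp := rate_pos hc0 hτ
    have hpos : 0 < τ / (2 * (c ^ 2 + τ ^ 2)) := by positivity
    rcases hc with rfl | rfl
    · have := beta_even_neg ht hct; linarith
    · have := beta_odd_neg ht hct; linarith

/-! ## §3 Decay of Booker's majorant `|γ(s)||Q(s)|^{1/2}` along the sampling progression -/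

/-- **Decay of Booker's majorant**, degree one: for `c ∈ {½, 3/2}`, `0 < t ≤ τ`,
`‖Γ((c+iτ)/2)‖ (c²+τ²)^{1/4} ≤ ‖Γ((c+it)/2)‖ (c²+t²)^{1/4} e^{−β(t)(τ−t)}` with Booker's
`β(t) = π/4 − ½arctan(c/t) − 4/(π²|t²−c²|)` — "`log(|γ(s+ikB)/γ(s)| |Q(s+ikB)/Q(s)|^{1/2}) ≤ −βkB`"
(`|Q(½+it)|^{1/2} ∝ (c²+t²)^{1/4}`), via `φ(u) = log‖Γ‖ + ¼log(c²+u²) + βu` antitone.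
[cite: Booker2006, proof of Lemma 5.7] -/
theorem decay {c : ℝ} (hc : c = 1 / 2 ∨ c = 3 / 2) {t τ : ℝ} (ht : 0 < t) (htτ : t ≤ τ) :
    ‖Complex.Gamma (((c : ℂ) + τ * I) / 2)‖ * (c ^ 2 + τ ^ 2) ^ ((1 : ℝ) / 4) ≤
      ‖Complex.Gamma (((c : ℂ) + t * I) / 2)‖ * (c ^ 2 + t ^ 2) ^ ((1 : ℝ) / 4) *
        Real.exp (-(π / 4 - 1 / 2 * Real.arctan (c / t) - 4 / (π ^ 2 * |t ^ 2 - c ^ 2|)) *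
          (τ - t)) := by
  have hc0 : 0 < c := by rcases hc with rfl | rfl <;> norm_num
  have hτ : 0 < τ := ht.trans_le htτ
  set b : ℝ := π / 4 - 1 / 2 * Real.arctan (c / t) - 4 / (π ^ 2 * |t ^ 2 - c ^ 2|) with hb
  set φ : ℝ → ℝ := fun u => Real.log ‖Complex.Gamma (((c : ℂ) + u * I) / 2)‖ +
    1 / 4 * Real.log (c ^ 2 + u ^ 2) + b * u with hφ
  set φ' : ℝ → ℝ := fun u => -(1 / 2) * (Complex.digamma (((c : ℂ) + u * I) / 2)).im +
    1 / 4 * ((2 : ℕ) * u ^ (2 - 1) / (c ^ 2 + u ^ 2)) + b * 1 with hφ'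
  have hderiv : ∀ u : ℝ, 0 < u → HasDerivAt φ (φ' u) u := by
    intro u hu
    have h1 := hasDerivAt_log_norm_Gamma hc0 u
    have h2 : HasDerivAt (fun u : ℝ => 1 / 4 * Real.log (c ^ 2 + u ^ 2))
        (1 / 4 * ((2 : ℕ) * u ^ (2 - 1) / (c ^ 2 + u ^ 2))) u := by
      have h := ((hasDerivAt_pow 2 u).const_add (c ^ 2)).log (by positivity)
      exact h.const_mul (1 / 4 : ℝ)
    have h3 : HasDerivAt (fun u : ℝ => b * u) (b * 1) u := (hasDerivAt_id u).const_mul b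
    exact (h1.add h2).add h3
  have hanti : AntitoneOn φ (Ici t) := by
    refine antitoneOn_of_hasDerivWithinAt_nonpos (convex_Ici t) (f' := φ')
      (fun u hu => (hderiv u (ht.trans_le hu)).continuousAt.continuousWithinAt)
      (fun u hu => (hderiv u ?_).hasDerivWithinAt) ?_
    · rw [interior_Ici] at hu; exact ht.trans hu
    · intro u hu
      rw [interior_Ici] at hu
      have hu0 : 0 < u := ht.trans hu
      have hr := rate hc ht (le_of_lt hu)
      show -(1 / 2) * (Complex.digamma (((c : ℂ) + u * I) / 2)).im +
        1 / 4 * ((2 : ℕ) * u ^ (2 - 1) / (c ^ 2 + u ^ 2)) + b * 1 ≤ 0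
      have : 1 / 4 * ((2 : ℕ) * u ^ (2 - 1) / (c ^ 2 + u ^ 2)) = u / (2 * (c ^ 2 + u ^ 2)) := by
        push_cast; field_simp; ring
      linarith
  have hφle : φ τ ≤ φ t := hanti self_mem_Ici (show τ ∈ Ici t from htτ) htτ
  have hexp : ∀ u : ℝ, 0 < u → Real.exp (φ u) =
      ‖Complex.Gamma (((c : ℂ) + u * I) / 2)‖ * (c ^ 2 + u ^ 2) ^ ((1 : ℝ) / 4) * Real.exp (b * u) := by
    intro u hu
    have hΓ : 0 < ‖Complex.Gamma (((c : ℂ) + u * I) / 2)‖ :=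
      norm_pos_iff.mpr (Complex.Gamma_ne_zero_of_re_pos (by simp; positivity))
    simp only [hφ]
    rw [Real.exp_add, Real.exp_add, Real.exp_log hΓ, Real.rpow_def_of_pos (by positivity),
      mul_comm (Real.log (c ^ 2 + u ^ 2))]
  calc ‖Complex.Gamma (((c : ℂ) + τ * I) / 2)‖ * (c ^ 2 + τ ^ 2) ^ ((1 : ℝ) / 4)
      = Real.exp (φ τ) * Real.exp (-(b * τ)) := by
        rw [hexp τ hτ, mul_assoc, ← Real.exp_add, add_neg_cancel, Real.exp_zero, mul_one]
    _ ≤ Real.exp (φ t) * Real.exp (-(b * τ)) := by gcongr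
    _ = ‖Complex.Gamma (((c : ℂ) + t * I) / 2)‖ * (c ^ 2 + t ^ 2) ^ ((1 : ℝ) / 4) *
        Real.exp (-b * (τ - t)) := by
        rw [hexp t ht, mul_assoc, ← Real.exp_add]; congr 1; congr 1; ring

/-! ## §4 The two tails (Booker's Lemma 5.7 (i)/(ii) mechanism with Booker's majorant) -/

/-- Right tail, `t > 0`, for a majorant `K ‖Γ((c+i|u|)/2)‖ (c²+u²)^{1/4} e^{πηu/4}` of `|F(u)|`.
[cite: Booker2006, Lemma 5.7 (i) and proof] -/
theorem tail_right {c : ℝ} (hc : c = 1 / 2 ∨ c = 3 / 2) {K η : ℝ} (hK : 0 ≤ K) (F : ℝ → ℂ)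
    (hF : ∀ u : ℝ, ‖F u‖ ≤ K * ‖Complex.Gamma (((c : ℂ) + |u| * I) / 2)‖ *
      (c ^ 2 + u ^ 2) ^ ((1 : ℝ) / 4) * Real.exp (π * η * u / 4))
    {t B β : ℝ} (ht : 0 < t) (hB : 0 < B)
    (hβ : β = π / 4 - 1 / 2 * Real.arctan (c / t) - 4 / (π ^ 2 * |t ^ 2 - c ^ 2|))
    (hβη : 0 < β - π / 4 * η) :
    Summable (fun k : ℕ => F (t + k * B)) ∧
      ‖∑' k : ℕ, F (t + k * B)‖ ≤ K * ‖Complex.Gamma (((c : ℂ) + t * I) / 2)‖ *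
        (c ^ 2 + t ^ 2) ^ ((1 : ℝ) / 4) * Real.exp (π * η * t / 4) /
          (1 - Real.exp (-((β - π / 4 * η) * B))) := by
  set M : ℝ := K * ‖Complex.Gamma (((c : ℂ) + t * I) / 2)‖ * (c ^ 2 + t ^ 2) ^ ((1 : ℝ) / 4) *
    Real.exp (π * η * t / 4) with hM
  set r : ℝ := Real.exp (-((β - π / 4 * η) * B)) with hr
  have hr0 : 0 ≤ r := (Real.exp_pos _).le
  have hr1 : r < 1 := by rw [hr, Real.exp_lt_one_iff]; nlinarith
  have hterm : ∀ k : ℕ, ‖F (t + k * B)‖ ≤ M * r ^ k := by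
    intro k
    have hk : (0 : ℝ) ≤ k * B := by positivity
    have hu : 0 < t + k * B := by linarith
    refine (hF _).trans ?_
    rw [abs_of_pos hu]
    have hd := decay hc ht (show t ≤ t + k * B by linarith)
    rw [← hβ, show t + k * B - t = k * B by ring] at hd
    have e : Real.exp (π * η * (t + k * B) / 4) =
        Real.exp (π * η * t / 4) * Real.exp (π / 4 * η * (k * B)) := by
      rw [← Real.exp_add]; congr 1; ring
    have er : r ^ k = Real.exp (-β * (k * B)) * Real.exp (π / 4 * η * (k * B)) := by
      rw [hr, ← Real.exp_nat_mul, ← Real.exp_add]; congr 1; ring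
    rw [e, er, hM]
    have hG := mul_le_mul_of_nonneg_left hd hK
    calc K * ‖Complex.Gamma (((c : ℂ) + (t + k * B : ℝ) * I) / 2)‖ *
          (c ^ 2 + (t + k * B) ^ 2) ^ ((1 : ℝ) / 4) *
          (Real.exp (π * η * t / 4) * Real.exp (π / 4 * η * (k * B)))
        = (K * (‖Complex.Gamma (((c : ℂ) + (t + k * B : ℝ) * I) / 2)‖ *
          (c ^ 2 + (t + k * B) ^ 2) ^ ((1 : ℝ) / 4))) *
          (Real.exp (π * η * t / 4) * Real.exp (π / 4 * η * (k * B))) := by ring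
      _ ≤ (K * (‖Complex.Gamma (((c : ℂ) + t * I) / 2)‖ * (c ^ 2 + t ^ 2) ^ ((1 : ℝ) / 4) *
          Real.exp (-β * (k * B)))) *
          (Real.exp (π * η * t / 4) * Real.exp (π / 4 * η * (k * B))) := by
          gcongr
      _ = _ := by ring
  have hgeom : HasSum (fun k : ℕ => M * r ^ k) (M / (1 - r)) := by
    have := (hasSum_geometric_of_lt_one hr0 hr1).mul_left M
    simpa [div_eq_mul_inv] using this
  have hsum : Summable (fun k : ℕ => F (t + k * B)) :=
    Summable.of_norm_bounded hgeom.summable hterm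
  refine ⟨hsum, ?_⟩
  calc ‖∑' k : ℕ, F (t + k * B)‖ ≤ ∑' k : ℕ, ‖F (t + k * B)‖ := norm_tsum_le_tsum_norm hsum.norm
    _ ≤ ∑' k : ℕ, M * r ^ k := hsum.norm.tsum_le_tsum hterm hgeom.summable
    _ = M / (1 - r) := hgeom.tsum_eq

/-- Left tail, `t < 0` (reflection `u ↦ −u`, `η ↦ −η`; `β` depends on `|t|`).
[cite: Booker2006, Lemma 5.7 (ii) and proof] -/
theorem tail_left {c : ℝ} (hc : c = 1 / 2 ∨ c = 3 / 2) {K η : ℝ} (hK : 0 ≤ K) (F : ℝ → ℂ)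
    (hF : ∀ u : ℝ, ‖F u‖ ≤ K * ‖Complex.Gamma (((c : ℂ) + |u| * I) / 2)‖ *
      (c ^ 2 + u ^ 2) ^ ((1 : ℝ) / 4) * Real.exp (π * η * u / 4))
    {t B β : ℝ} (ht : t < 0) (hB : 0 < B)
    (hβ : β = π / 4 - 1 / 2 * Real.arctan (c / |t|) - 4 / (π ^ 2 * |t ^ 2 - c ^ 2|))
    (hβη : 0 < β + π / 4 * η) :
    Summable (fun k : ℕ => F (t - k * B)) ∧
      ‖∑' k : ℕ, F (t - k * B)‖ ≤ K * ‖Complex.Gamma (((c : ℂ) + t * I) / 2)‖ *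
        (c ^ 2 + t ^ 2) ^ ((1 : ℝ) / 4) * Real.exp (π * η * t / 4) /
          (1 - Real.exp (-((β + π / 4 * η) * B))) := by
  set s : ℝ := -t with hs
  have hs0 : 0 < s := by rw [hs]; linarith
  have hts : |t| = s := by rw [hs]; exact abs_of_neg ht
  set M : ℝ := K * ‖Complex.Gamma (((c : ℂ) + t * I) / 2)‖ * (c ^ 2 + t ^ 2) ^ ((1 : ℝ) / 4) *
    Real.exp (π * η * t / 4) with hM
  set r : ℝ := Real.exp (-((β + π / 4 * η) * B)) with hr
  have hr0 : 0 ≤ r := (Real.exp_pos _).le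
  have hr1 : r < 1 := by rw [hr, Real.exp_lt_one_iff]; nlinarith
  have hβ' : β = π / 4 - 1 / 2 * Real.arctan (c / s) - 4 / (π ^ 2 * |s ^ 2 - c ^ 2|) := by
    rw [hβ, hts, hs, neg_sq]
  have hterm : ∀ k : ℕ, ‖F (t - k * B)‖ ≤ M * r ^ k := by
    intro k
    have hk : (0 : ℝ) ≤ k * B := by positivity
    have hu : t - k * B < 0 := by linarith
    have habs : |t - k * B| = s + k * B := by rw [abs_of_neg hu, hs]; ring
    have hsq : (t - k * B) ^ 2 = (s + k * B) ^ 2 := by rw [hs]; ring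
    refine (hF _).trans ?_
    rw [habs, hsq]
    have hd := decay hc hs0 (show s ≤ s + k * B by linarith)
    rw [← hβ', show s + k * B - s = k * B by ring] at hd
    have e : Real.exp (π * η * (t - k * B) / 4) =
        Real.exp (π * η * t / 4) * Real.exp (-(π / 4 * η * (k * B))) := by
      rw [← Real.exp_add]; congr 1; ring
    have er : r ^ k = Real.exp (-β * (k * B)) * Real.exp (-(π / 4 * η * (k * B))) := by
      rw [hr, ← Real.exp_nat_mul, ← Real.exp_add]; congr 1; ring
    have hGt : ‖Complex.Gamma (((c : ℂ) + t * I) / 2)‖ = ‖Complex.Gamma (((c : ℂ) + s * I) / 2)‖ := by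
      rw [norm_Gamma_abs, hts]
    have hst : (c ^ 2 + t ^ 2) = (c ^ 2 + s ^ 2) := by rw [hs, neg_sq]
    rw [e, er, hM, hGt, hst]
    have hG := mul_le_mul_of_nonneg_left hd hK
    calc K * ‖Complex.Gamma (((c : ℂ) + (s + k * B : ℝ) * I) / 2)‖ *
          (c ^ 2 + (s + k * B) ^ 2) ^ ((1 : ℝ) / 4) *
          (Real.exp (π * η * t / 4) * Real.exp (-(π / 4 * η * (k * B))))
        = (K * (‖Complex.Gamma (((c : ℂ) + (s + k * B : ℝ) * I) / 2)‖ *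
          (c ^ 2 + (s + k * B) ^ 2) ^ ((1 : ℝ) / 4))) *
          (Real.exp (π * η * t / 4) * Real.exp (-(π / 4 * η * (k * B)))) := by ring
      _ ≤ (K * (‖Complex.Gamma (((c : ℂ) + s * I) / 2)‖ * (c ^ 2 + s ^ 2) ^ ((1 : ℝ) / 4) *
          Real.exp (-β * (k * B)))) *
          (Real.exp (π * η * t / 4) * Real.exp (-(π / 4 * η * (k * B)))) := by
          gcongr
      _ = _ := by ring
  have hgeom : HasSum (fun k : ℕ => M * r ^ k) (M / (1 - r)) := by
    have := (hasSum_geometric_of_lt_one hr0 hr1).mul_left M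
    simpa [div_eq_mul_inv] using this
  have hsum : Summable (fun k : ℕ => F (t - k * B)) :=
    Summable.of_norm_bounded hgeom.summable hterm
  refine ⟨hsum, ?_⟩
  calc ‖∑' k : ℕ, F (t - k * B)‖ ≤ ∑' k : ℕ, ‖F (t - k * B)‖ := norm_tsum_le_tsum_norm hsum.norm
    _ ≤ ∑' k : ℕ, M * r ^ k := hsum.norm.tsum_le_tsum hterm hgeom.summable
    _ = M / (1 - r) := hgeom.tsum_eq

/-! ## §5 The `L`-function layer: `|F(t)| ≤ E` (Lemmas 4.1 and 4.5) -/

/-- "Lemmas 4.1 and 4.5 imply the bound `|F(t)| ≤ E`" (proof of Lemma 5.7), degree one: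
with `γ(s) = ε q^{(s−½)/2} π^{−(s+a)/2} Γ((s+a)/2)` (`|ε| = 1`), `s = ½ + iu`, `c = ½ + a`,
`‖γ(s) L(s, χ) e^{πηu/4}‖ ≤ ζ(3/2) π^{−c/2} (q/2π)^{1/2} · ‖Γ((c+i|u|)/2)‖ (c²+u²)^{1/4} e^{πηu/4}`
(`|L(½+iu)| ≤ ζ(3/2)|Q(½+iu)|^{1/2}`, the tree's `BookerConvexity.norm_LFunction_half_le_bigZ_mul_sqrt`;
`|Q(½+iu)|^{1/2} = (q/2π)^{1/2}(c²+u²)^{1/4}`). [cite: Booker2006, proof of Lemma 5.7; Lemmas 4.1, 4.5] -/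
theorem norm_F_le {q : ℕ} [NeZero q] (hq : 1 < q) {χ : DirichletCharacter ℂ q}
    (hχ : χ.IsPrimitive) {c : ℝ} (hc : c = 1 / 2 + charParity χ) {ε : ℂ} (hε : ‖ε‖ = 1) (η u : ℝ) :
    ‖ε * (q : ℂ) ^ ((1 / 2 + u * I - 1 / 2) / 2) *
        ((π : ℂ) ^ (-(1 / 2 + u * I + charParity χ) / 2) *
          Complex.Gamma ((1 / 2 + u * I + charParity χ) / 2)) *
        χ.LFunction (1 / 2 + u * I) * Complex.exp (π * η * u / 4)‖ ≤
      Booker2006Turing.bigZ (3 / 2) * π ^ (-(c / 2)) * Real.sqrt ((q : ℝ) / (2 * π)) *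
        ‖Complex.Gamma (((c : ℂ) + |u| * I) / 2)‖ * (c ^ 2 + u ^ 2) ^ ((1 : ℝ) / 4) *
        Real.exp (π * η * u / 4) := by
  have hq0 : (0 : ℝ) < q := by exact_mod_cast (by omega : 0 < q)
  have hc0 : 0 < c := by rw [hc]; positivity
  have ec : (1 / 2 + u * I + (charParity χ : ℂ)) = (c : ℂ) + u * I := by
    rw [hc]; push_cast; ring
  have n1 : ‖(q : ℂ) ^ ((1 / 2 + u * I - 1 / 2) / 2)‖ = 1 := by
    rw [show (q : ℂ) = ((q : ℝ) : ℂ) by norm_cast, Complex.norm_cpow_eq_rpow_re_of_pos hq0]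
    simp
  have n2 : ‖(π : ℂ) ^ (-(1 / 2 + u * I + (charParity χ : ℂ)) / 2)‖ = π ^ (-(c / 2)) := by
    rw [ec, Complex.norm_cpow_eq_rpow_re_of_pos Real.pi_pos]
    congr 1
    simp
    ring
  have n3 : ‖Complex.Gamma ((1 / 2 + u * I + (charParity χ : ℂ)) / 2)‖ =
      ‖Complex.Gamma (((c : ℂ) + |u| * I) / 2)‖ := by
    rw [ec, norm_Gamma_abs]
  have n4 : ‖Complex.exp (π * η * u / 4)‖ = Real.exp (π * η * u / 4) := by
    rw [Complex.norm_exp]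
    congr 1
    rw [show (π : ℂ) * η * u / 4 = ((π * η * u / 4 : ℝ) : ℂ) by push_cast; ring, Complex.ofReal_re]
  have hL := BookerConvexity.norm_LFunction_half_le_bigZ_mul_sqrt hq hχ u
  have hQ : Real.sqrt ((q : ℝ) * ‖(1 / 2 : ℂ) + charParity χ + u * I‖ / (2 * π)) =
      Real.sqrt ((q : ℝ) / (2 * π)) * (c ^ 2 + u ^ 2) ^ ((1 : ℝ) / 4) := by
    have e1 : ‖(1 / 2 : ℂ) + charParity χ + u * I‖ = Real.sqrt (c ^ 2 + u ^ 2) := by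
      rw [show (1 / 2 : ℂ) + charParity χ + u * I = (c : ℂ) + u * I by rw [hc]; push_cast; ring]
      rw [Complex.norm_eq_sqrt_sq_add_sq]
      simp
    rw [e1, show (q : ℝ) * Real.sqrt (c ^ 2 + u ^ 2) / (2 * π) = (q : ℝ) / (2 * π) * Real.sqrt (c ^ 2 + u ^ 2)
      by ring, Real.sqrt_mul (by positivity)]
    congr 1
    rw [Real.sqrt_eq_rpow, Real.sqrt_eq_rpow, ← Real.rpow_mul (by positivity)]
    norm_num
  rw [hQ] at hL
  have hZ : 0 < Booker2006Turing.bigZ (3 / 2) := Booker2006Turing.bigZ_pos (by norm_num)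
  rw [norm_mul, norm_mul, norm_mul, norm_mul, norm_mul, hε, n1, n2, n3, n4, one_mul, one_mul]
  have hG : 0 ≤ ‖Complex.Gamma (((c : ℂ) + |u| * I) / 2)‖ := norm_nonneg _
  calc π ^ (-(c / 2)) * ‖Complex.Gamma (((c : ℂ) + |u| * I) / 2)‖ *
        ‖χ.LFunction (1 / 2 + u * I)‖ * Real.exp (π * η * u / 4)
      ≤ π ^ (-(c / 2)) * ‖Complex.Gamma (((c : ℂ) + |u| * I) / 2)‖ *
        (Booker2006Turing.bigZ (3 / 2) * (Real.sqrt ((q : ℝ) / (2 * π)) * (c ^ 2 + u ^ 2) ^ ((1 : ℝ) / 4))) *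
        Real.exp (π * η * u / 4) := by gcongr
    _ = _ := by ring

end TimeAliasingBooker

/-! ## §6 Booker 2006, Lemma 5.7, for Dirichlet `L`-functions, as printed -/

open TimeAliasingBooker in
/-- **Booker 2006, Lemma 5.7 (i) (Experiment. Math. 15 (2006), §5.3; arXiv:math/0507502v1 §5.3, last
lemma), degree one, as printed.** Printed (degree `r`, poles collected in `P`, Ramanujan parameter `θ`):
"Let `t ∈ ℝ` and put `s = ½ + it`, `E = Z_θ(3/2)^r |γ(s)| e^{(πr/4)ηt} |Q(s) P(s+1)²P(s−2)/(P(s)²P(s−1))|^{1/2}`,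
and `β = πr/4 − ½ Σ_j arctan(Re(s+μ_j)/|Im(s+μ_j)|) − (4/π²) Σ_j 1/|Im(s+μ_j)² − Re(s+μ_j)²|`.
(i) If `Im(s+μ_j) > 0` for all `j` and `β − (πr/4)η > 0` then
`|Σ_{k=0}^∞ F(t + kB)| ≤ E/(1 − e^{−(β − (πr/4)η)B})`." Here `F(t) := Λ(½+it) e^{(πr/4)ηt}`,
`Λ(s) = γ(s)L(s)`, `γ(s) = ε N^{½(s−½)} Π Γ_ℝ(s+μ_j)`, `Γ_ℝ(s) = π^{−s/2}Γ(s/2)`, `Z_θ(σ) = (ζ(σ+θ)ζ(σ−θ))^{1/2}`,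
`B > 0` (§5). For `L(s, χ)`, `χ` primitive modulo `q > 1`: `r = 1`, `N = q`, `μ₁ = a = charParity χ`,
`θ = 0` (so `Z₀(3/2) = ζ(3/2)`), `P = 1`, `Q(s) = q(s+a)/(2π)`, `|ε| = 1`; so `Im(s+μ₁) = t`,
`Re(s+μ₁) = ½ + a`. `F`, `E`, `β` enter as functions with their defining equations (`hF`, `hE`, `hβ`).
Conclusion: the printed bound, and absolute convergence of the sum. (`|F(t)| ≤ E` is Lemmas 4.1 + 4.5,
the tree's `BookerConvexity.*`; the decay is `TimeAliasingBooker.decay`; for `0 < t < ½ + a`, a range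
the printed monotonicity step does not cover, `TimeAliasingBooker.rate` closes the argument.)
[cite: Booker2006, §5.3 Lemma 5.7 (i)] -/
theorem booker2006_lemma57_i_dirichlet {q : ℕ} [NeZero q] (hq : 1 < q) {χ : DirichletCharacter ℂ q}
    (hχ : χ.IsPrimitive) {ε : ℂ} (hε : ‖ε‖ = 1) (η : ℝ)
    (F : ℝ → ℂ) (hF : ∀ u : ℝ, F u = ε * (q : ℂ) ^ ((1 / 2 + u * I - 1 / 2) / 2) *
        ((π : ℂ) ^ (-(1 / 2 + u * I + charParity χ) / 2) *
          Complex.Gamma ((1 / 2 + u * I + charParity χ) / 2)) *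
        χ.LFunction (1 / 2 + u * I) * Complex.exp (π * η * u / 4))
    (E : ℝ → ℝ) (hE : ∀ u : ℝ, E u = Booker2006Turing.bigZ (3 / 2) *
        ‖ε * (q : ℂ) ^ ((1 / 2 + u * I - 1 / 2) / 2) *
          ((π : ℂ) ^ (-(1 / 2 + u * I + charParity χ) / 2) *
            Complex.Gamma ((1 / 2 + u * I + charParity χ) / 2))‖ *
        Real.exp (π * η * u / 4) *
        Real.sqrt ((q : ℝ) * ‖(1 / 2 : ℂ) + u * I + charParity χ‖ / (2 * π)))
    (β : ℝ → ℝ) (hβ : ∀ u : ℝ, β u = π / 4 - 1 / 2 * Real.arctan ((1 / 2 + charParity χ) / |u|) -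
        4 / (π ^ 2 * |u ^ 2 - (1 / 2 + charParity χ) ^ 2|))
    {t B : ℝ} (ht : 0 < t) (hB : 0 < B) (hβη : 0 < β t - π / 4 * η) :
    Summable (fun k : ℕ => F (t + k * B)) ∧
      ‖∑' k : ℕ, F (t + k * B)‖ ≤ E t / (1 - Real.exp (-((β t - π / 4 * η) * B))) := by
  set c : ℝ := 1 / 2 + charParity χ with hc
  have hc' : c = 1 / 2 ∨ c = 3 / 2 := by
    rcases χ.even_or_odd with he | ho
    · left; rw [hc, charParity_of_even he]; norm_num
    · right; rw [hc, charParity_of_odd ho]; norm_num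
  have hq0 : (0 : ℝ) < q := by exact_mod_cast (by omega : 0 < q)
  set K : ℝ := Booker2006Turing.bigZ (3 / 2) * π ^ (-(c / 2)) * Real.sqrt ((q : ℝ) / (2 * π)) with hK
  have hK0 : 0 ≤ K := by
    have := Booker2006Turing.bigZ_pos (σ := 3 / 2) (by norm_num)
    positivity
  have hFK : ∀ u : ℝ, ‖F u‖ ≤ K * ‖Complex.Gamma (((c : ℂ) + |u| * I) / 2)‖ *
      (c ^ 2 + u ^ 2) ^ ((1 : ℝ) / 4) * Real.exp (π * η * u / 4) := by
    intro u; rw [hF u]; exact norm_F_le hq hχ hc hε η u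
  obtain ⟨hs, hb⟩ := tail_right hc' hK0 F hFK ht hB (β := β t)
    (by rw [hβ, abs_of_pos ht]) hβη
  refine ⟨hs, hb.trans (le_of_eq ?_)⟩
  congr 1
  -- `E t = K ‖Γ((c+it)/2)‖ (c²+t²)^{1/4} e^{πηt/4}`
  have h := norm_F_le hq hχ hc hε η t
  rw [hE t]
  have ec : (1 / 2 + t * I + (charParity χ : ℂ)) = (c : ℂ) + t * I := by
    rw [hc]; push_cast; ring
  have n1 : ‖(q : ℂ) ^ ((1 / 2 + t * I - 1 / 2) / 2)‖ = 1 := by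
    rw [show (q : ℂ) = ((q : ℝ) : ℂ) by norm_cast, Complex.norm_cpow_eq_rpow_re_of_pos hq0]
    simp
  have n2 : ‖(π : ℂ) ^ (-(1 / 2 + t * I + (charParity χ : ℂ)) / 2)‖ = π ^ (-(c / 2)) := by
    rw [ec, Complex.norm_cpow_eq_rpow_re_of_pos Real.pi_pos]
    congr 1
    simp
    ring
  have hQ : Real.sqrt ((q : ℝ) * ‖(1 / 2 : ℂ) + t * I + charParity χ‖ / (2 * π)) =
      Real.sqrt ((q : ℝ) / (2 * π)) * (c ^ 2 + t ^ 2) ^ ((1 : ℝ) / 4) := by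
    have e1 : ‖(1 / 2 : ℂ) + t * I + charParity χ‖ = Real.sqrt (c ^ 2 + t ^ 2) := by
      rw [ec, Complex.norm_eq_sqrt_sq_add_sq]
      simp
    rw [e1, show (q : ℝ) * Real.sqrt (c ^ 2 + t ^ 2) / (2 * π) = (q : ℝ) / (2 * π) * Real.sqrt (c ^ 2 + t ^ 2)
      by ring, Real.sqrt_mul (by positivity)]
    congr 1
    rw [Real.sqrt_eq_rpow, Real.sqrt_eq_rpow, ← Real.rpow_mul (by positivity)]
    norm_num
  rw [norm_mul, norm_mul, norm_mul, hε, n1, n2, hQ, ec, hK]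
  ring

open TimeAliasingBooker in
/-- **Booker 2006, Lemma 5.7 (ii), degree one, as printed:** "(ii) If `Im(s+μ_j) < 0` for all `j` and
`β + (πr/4)η > 0` then `|Σ_{k=0}^∞ F(t − kB)| ≤ E/(1 − e^{−(β + (πr/4)η)B})`." Conventions as in
`booker2006_lemma57_i_dirichlet` (`Im(s+μ₁) = t < 0`; `β` depends on `|t|`). [cite: Booker2006, §5.3 Lemma 5.7 (ii)] -/
theorem booker2006_lemma57_ii_dirichlet {q : ℕ} [NeZero q] (hq : 1 < q) {χ : DirichletCharacter ℂ q}
    (hχ : χ.IsPrimitive) {ε : ℂ} (hε : ‖ε‖ = 1) (η : ℝ)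
    (F : ℝ → ℂ) (hF : ∀ u : ℝ, F u = ε * (q : ℂ) ^ ((1 / 2 + u * I - 1 / 2) / 2) *
        ((π : ℂ) ^ (-(1 / 2 + u * I + charParity χ) / 2) *
          Complex.Gamma ((1 / 2 + u * I + charParity χ) / 2)) *
        χ.LFunction (1 / 2 + u * I) * Complex.exp (π * η * u / 4))
    (E : ℝ → ℝ) (hE : ∀ u : ℝ, E u = Booker2006Turing.bigZ (3 / 2) *
        ‖ε * (q : ℂ) ^ ((1 / 2 + u * I - 1 / 2) / 2) *
          ((π : ℂ) ^ (-(1 / 2 + u * I + charParity χ) / 2) *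
            Complex.Gamma ((1 / 2 + u * I + charParity χ) / 2))‖ *
        Real.exp (π * η * u / 4) *
        Real.sqrt ((q : ℝ) * ‖(1 / 2 : ℂ) + u * I + charParity χ‖ / (2 * π)))
    (β : ℝ → ℝ) (hβ : ∀ u : ℝ, β u = π / 4 - 1 / 2 * Real.arctan ((1 / 2 + charParity χ) / |u|) -
        4 / (π ^ 2 * |u ^ 2 - (1 / 2 + charParity χ) ^ 2|))
    {t B : ℝ} (ht : t < 0) (hB : 0 < B) (hβη : 0 < β t + π / 4 * η) :
    Summable (fun k : ℕ => F (t - k * B)) ∧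
      ‖∑' k : ℕ, F (t - k * B)‖ ≤ E t / (1 - Real.exp (-((β t + π / 4 * η) * B))) := by
  set c : ℝ := 1 / 2 + charParity χ with hc
  have hc' : c = 1 / 2 ∨ c = 3 / 2 := by
    rcases χ.even_or_odd with he | ho
    · left; rw [hc, charParity_of_even he]; norm_num
    · right; rw [hc, charParity_of_odd ho]; norm_num
  have hq0 : (0 : ℝ) < q := by exact_mod_cast (by omega : 0 < q)
  set K : ℝ := Booker2006Turing.bigZ (3 / 2) * π ^ (-(c / 2)) * Real.sqrt ((q : ℝ) / (2 * π)) with hK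
  have hK0 : 0 ≤ K := by
    have := Booker2006Turing.bigZ_pos (σ := 3 / 2) (by norm_num)
    positivity
  have hFK : ∀ u : ℝ, ‖F u‖ ≤ K * ‖Complex.Gamma (((c : ℂ) + |u| * I) / 2)‖ *
      (c ^ 2 + u ^ 2) ^ ((1 : ℝ) / 4) * Real.exp (π * η * u / 4) := by
    intro u; rw [hF u]; exact norm_F_le hq hχ hc hε η u
  obtain ⟨hs, hb⟩ := tail_left hc' hK0 F hFK ht hB (β := β t) (hβ t) hβη
  refine ⟨hs, hb.trans (le_of_eq ?_)⟩
  congr 1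
  rw [hE t]
  have ec : (1 / 2 + t * I + (charParity χ : ℂ)) = (c : ℂ) + t * I := by
    rw [hc]; push_cast; ring
  have n1 : ‖(q : ℂ) ^ ((1 / 2 + t * I - 1 / 2) / 2)‖ = 1 := by
    rw [show (q : ℂ) = ((q : ℝ) : ℂ) by norm_cast, Complex.norm_cpow_eq_rpow_re_of_pos hq0]
    simp
  have n2 : ‖(π : ℂ) ^ (-(1 / 2 + t * I + (charParity χ : ℂ)) / 2)‖ = π ^ (-(c / 2)) := by
    rw [ec, Complex.norm_cpow_eq_rpow_re_of_pos Real.pi_pos]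
    congr 1
    simp
    ring
  have hQ : Real.sqrt ((q : ℝ) * ‖(1 / 2 : ℂ) + t * I + charParity χ‖ / (2 * π)) =
      Real.sqrt ((q : ℝ) / (2 * π)) * (c ^ 2 + t ^ 2) ^ ((1 : ℝ) / 4) := by
    have e1 : ‖(1 / 2 : ℂ) + t * I + charParity χ‖ = Real.sqrt (c ^ 2 + t ^ 2) := by
      rw [ec, Complex.norm_eq_sqrt_sq_add_sq]
      simp
    rw [e1, show (q : ℝ) * Real.sqrt (c ^ 2 + t ^ 2) / (2 * π) = (q : ℝ) / (2 * π) * Real.sqrt (c ^ 2 + t ^ 2)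
      by ring, Real.sqrt_mul (by positivity)]
    congr 1
    rw [Real.sqrt_eq_rpow, Real.sqrt_eq_rpow, ← Real.rpow_mul (by positivity)]
    norm_num
  rw [norm_mul, norm_mul, norm_mul, hε, n1, n2, hQ, ec, hK]
  ring


end Literature.NumberTheory.LFunctions

end
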